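import Summits.QuantumFields.YangMills.Theorems.BalabanUVNodesN07ChartLinAverageFlat
import Summits.QuantumFields.YangMills.Theorems.BalabanUVNodesN07EmapOfRecordTraceSectors
import Summits.QuantumFields.YangMills.Theorems.BalabanUVNodesN07LieTokAtOfRecordTwo
import HarnessLib

/-!
# N07 at the record, `N = 2` — THE `SU`-EXPONENT ROW AND THE TRACE ROW OF THE FRAME-FREE (47)-CARRYING CHART FROM THE REALITY ROWS: `LieLinTokAt T♭ V`
# for `bgSchemeOfRecord` whenever `𝒜♭(V) + 𝔄♭(V)` is a Hermitian traceless jet (g26 ✓`conjJet_T47OfRecord_eq` + g27 ✓`trace_equiv_T47OfRecord_eq_zero_two`),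
# and (rng) ∧ (star_mem)'s average conjunct `Ū^k(𝔖♭.chartCfgLin T♭ V) = V` with those two rows DISCHARGED

Cell `pub-ymgap`, seat `pub-ymgap-dag-n07-w3` (g28, WIDTH SEAT 3 on N07 [B11]); helper file keyed `--supports stmt-QuantumFields-27238 --as helper` (K0ᴬ road);
count-neutral.  INTENT-16 of the seat.

## What is here (`N = 2`; slot `T♭ := fun _ => T47 (H1OfRecordAtBgFlat …) (CslOfRecord …) ε_C` inline)

* ★★ `lieLinTokAtFlat_of_rows` — (A4)'s `LieLinTokAt T♭ V` («the exponent `i·ev(T♭(𝒜♭(V) + 𝔄♭(V)))(b)` lies in `𝔰𝔲(2)` on every bond») from: the guard of `U₀` below `k`,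
  the Sect. C `Regime`, the reality rows `hCreal` ∕ `hCtr` of `C^{sl}` (displayed as in g26 ∕ g27), and the REALITY OF THE PRE-(47) FIELD `A′ := 𝒜♭(V) + 𝔄♭(V)`
  (Hermitian jet, traceless jet, `‖A′‖ < a_C`) — by g26's ✓`conjJet_T47OfRecord_eq` (Hermitian) and g27's ✓`trace_equiv_T47OfRecord_eq_zero_two` (traceless) read at
  the record's bonds through `bondToLit`, and lit ✓`I_smul_mem_lieSU_of_mem_herm0`.
* ★ `expoLinAt_sol_memFlat_of_rows` — hence the `SU`-exponent row at the fixed point ((A4) ✓`expoLinAt_sol_mem_of_lieLinTokAt`); ★ `traceRow_T47Flat_of_rows` — and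
  the trace row of ✓`iter_chartCfgLinFlat_eq` (g27's theorem, restated at the scheme's `A′` for the consumer).
* ★ `herm0_of_I_smul_mem_lieSU` (converse of ✓`BgScheme.I_smul_mem_lieSU_of_mem_herm0`), ★★ `realRows_of_lieTokAt` — the EXISTING Lie token of the Prop. 6 chart of record
  (`𝔖♭.LieTokAt V`, g27 ✓`lieTokAt_bgSchemeOfRecord_two` at `N = 2` under displayed rows) IS the reality of `A′` as full jets (✓`mem_evHerm0_ofRecord_iff`).
* ★★★ `iter_chartCfgLinFlat_eq_of_realRows` ∕ ★★★ `exists_radius_iter_chartCfgLinFlat_eq_of_realRows` — ✓`iter_chartCfgLinFlat_eq` ∕ ✓`exists_radius_iter_chartCfgLinFlat_eq`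
  with the trace row AND the `SU`-exponent row REPLACED by the reality of `A′` (+ `hCreal`, `hCtr`): what remains displayed is exactly the reality programme's
  standard output «`𝒜♭(V) + 𝔄♭(V)` is a Hermitian traceless jet» (✓`Node00.BgSchemeChartLie.sol_mem_of_rows` with `TY :=` Hermitian-traceless jets; its `W`-row
  reality half is g26's ✓`WOfRecordAt_herm`), the `Regime`s ∕ `Prop4Hyp`, `‖J‖ ≤ j`, `FrakGSliceTok`, `hCreal`, `hCtr`;
  ★★★★ `iter_chartCfgLinFlat_eq_of_lieTokAt` ∕ ★★★★ `exists_radius_iter_chartCfgLinFlat_eq_of_lieTokAt` — the same keyed on `𝔖♭.LieTokAt V` itself: THE (47)-FREE CHART's OWN Lie token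
  (already a theorem at `N = 2`) carries the (47)-carrying chart's `SU`-exponent AND trace rows.

## Honest labels

`*`-algebra bookkeeping on landed rows; `N = 2` because the trace half of the `T47` row is g27's `N = 2` theorem.  Nothing of Bałaban's estimates; K0ᴬ ⟨27238⟩ NOT closed;
N07 NOT discharged; R4 is the conditional finite-𝕋⁴ rung `BalabanLadder.UV` only; finite torus at fixed `ε` — nothing continuum ∕ OS ∕ Clay.
**The Yang–Mills mass gap is NOT proved by any of this.**  No `sorry`, no `def`, no `instance ∕ notation`; standard axioms.
[cite: Balaban1985Variational, (15) p.280, (19) p.281, (47)–(51) pp.285–286, Prop. 6 p.295, Prop. 9 p.309; Balaban1985Averaging, (17)–(19) p.21; Balaban1987RG1, (0.21) p.256]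
-/

set_option autoImplicit false

noncomputable section

open scoped Matrix Matrix.Norms.L2Operator InnerProductSpace Topology

namespace Summit.QuantumFields.YangMills.Theorems.N07ChartLinFlatLieTok

open Literature.MathematicalPhysics.QuantumFieldTheory.Balaban1983to89
open Literature.MathematicalPhysics.QuantumFieldTheory.Balaban1983to89.T4Continuum (T4Family)
open Literature.MathematicalPhysics.QuantumFieldTheory.Balaban1983to89.Node00
open B15AveragingHolomorphic (iterMh)
open B9SectCLatticeCarrier (Bond)
open B9AdOrthogonal (herm0 mem_herm0)
open T4AdjointCovarianceUnitary (lieSU mem_lieSU_iff)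
open B11Eq103H1Complex (SiteL2K BondL2K)
open B11Eq111FrakG (nabla115)
open B11Eq115Space (NegSize NegSup JetSup)
open B11Eq174Chart (Regime)
open B11Prop6Scheme (Prop4Hyp)
open B11Eq90V0GroupComposed (T47)
open Summit.QuantumFields.YangMills.Theorems.N07EmapOfRecordRealSlice (conjJet_T47OfRecord_eq)
open Summit.QuantumFields.YangMills.Theorems.N07EmapOfRecordTraceSectors (trace_equiv_T47OfRecord_eq_zero_two)
open Summit.QuantumFields.YangMills.Theorems.N07ChartLinAverageFlat (iter_chartCfgLinFlat_eq exists_radius_iter_chartCfgLinFlat_eq)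
open Summit.QuantumFields.YangMills.Theorems.N07LieTokAtOfRecordTwo (mem_evHerm0_ofRecord_iff)

section Two

variable (F : T4Family) {K : ℕ} (k : ℕ) (Ω : ℕ → Set (Site (F.P K) 0)) (U₀ : GaugeField (F.P K) 0 (SU 2))
  [Fact (0 < (F.L : ℝ))] [Fact (0 < (F.P K).eta k)] (levB : PBond (F.P K) k → ℕ) [Fact (0 < c0Rec F K k)] [Fact (∀ c, 0 < wBRec F K k c)] (a : ℝ)
  (hposb : ∀ x, x ≠ 0 → 0 < RCLike.re ⟪x, laplaceAOfRecord F 2 k U₀ (QOfRecord F 2 k U₀) (QflatOfRecord F 2 k) a x⟫_ℂ)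
  (hQ : Function.Surjective (QOfRecord F 2 k U₀)) {b C₂ c₄ aC εC : ℝ}
  (RC : Regime (H1OfRecordAtBgFlat F 2 K k Ω U₀ levB a hposb hQ) 0 (CslOfRecord F 2 K k Ω U₀ levB) b 0 C₂ c₄ 0 aC εC)
  (hCreal : ∀ A : Space115Lit F 2 K k Ω U₀,
    ((JetSup.equiv _ _ (nabla115 ((F.P K).eta k) (unitsOfRecord F 2 U₀))).symm
        (star (JetSup.equiv _ _ (nabla115 ((F.P K).eta k) (unitsOfRecord F 2 U₀)) A)) : Space115Lit F 2 K k Ω U₀) = A →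
    ‖A‖ ≤ εC + aC → ((NegSup.equiv _ _).symm (star (NegSup.equiv _ _ (CslOfRecord F 2 K k Ω U₀ levB A))) :
      NegSize (F.L : ℝ) ((F.P K).eta k) levB 0 (Matrix (Fin 2) (Fin 2) ℂ)) = CslOfRecord F 2 K k Ω U₀ levB A)
  (hCtr : ∀ A : Space115Lit F 2 K k Ω U₀,
    ((JetSup.equiv _ _ (nabla115 ((F.P K).eta k) (unitsOfRecord F 2 U₀))).symm
        (star (JetSup.equiv _ _ (nabla115 ((F.P K).eta k) (unitsOfRecord F 2 U₀)) A)) : Space115Lit F 2 K k Ω U₀) = A →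
    (∀ b, (JetSup.equiv _ _ (nabla115 ((F.P K).eta k) (unitsOfRecord F 2 U₀)) A b).trace = 0) →
    ‖A‖ ≤ εC + aC → ∀ c, (NegSup.equiv _ _ (CslOfRecord F 2 K k Ω U₀ levB A) c).trace = 0)
  (Gp : SiteL2K ℂ (F.P K).d (fun _ => (F.P K).sitesPerDir 0) (c0Rec F K k) (WRec 2) →ₗ[ℂ]
    SiteL2K ℂ (F.P K).d (fun _ => (F.P K).sitesPerDir 0) (c0Rec F K k) (WRec 2))
  (Δ2 : BondL2K ℂ (F.P K).d (fun _ => (F.P K).sitesPerDir 0) (c0Rec F K k) (WRec 2) →ₗ[ℂ]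
    BondL2K ℂ (F.P K).d (fun _ => (F.P K).sitesPerDir 0) (c0Rec F K k) (WRec 2))
  (hposπ : ∀ x, x ≠ 0 → 0 < RCLike.re ⟪x, laplaceAOfRecordAt F 2 k U₀ (hessOpOfRecord128 F 2 k U₀ Gp (QflatOfRecord F 2 k) Δ2)
    (QOfRecord F 2 k U₀) (QflatOfRecord F 2 k) a x⟫_ℂ)
  (dom : Set (GaugeField (F.P K) k (SU 2))) (B₀ C₄ a₃ j a𝔄 ε₄ : ℝ)

include RC hCreal hCtr in
/-- ★★ **THE LIE TOKEN OF THE FRAME-FREE (47)-CARRYING CHART FROM THE REALITY ROWS** (`N = 2`): if the pre-(47) field `A′ := 𝒜♭(V) + 𝔄♭(V)` is a Hermitian traceless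
jet with `‖A′‖ < a_C`, then `i·ev(T♭ A′)(b) ∈ 𝔰𝔲(2)` on every record bond (`T♭ A′` is Hermitian — g26 — and traceless-presented — g27; `ev = η•evLit` samples the jet at
`bondToLit b`; `η` real). [cite: Balaban1985Variational, (15) p.280, (19) p.281, (47) p.285, (51) p.286, Prop. 9 p.309; Balaban1985Averaging, (17)–(19) p.21] -/
theorem lieLinTokAtFlat_of_rows (h : SmallBelow (avOfRecord F 2 K) k U₀) {V : GaugeField (F.P K) k (SU 2)}
    (hA'herm : ((JetSup.equiv _ _ (nabla115 ((F.P K).eta k) (unitsOfRecord F 2 U₀))).symm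
      (star (JetSup.equiv _ _ (nabla115 ((F.P K).eta k) (unitsOfRecord F 2 U₀))
        ((bgSchemeOfRecord F 2 K k Ω U₀ dom levB Gp Δ2 a hposπ hposb hQ εC B₀ C₄ a₃ j a𝔄 ε₄).sol V + frakAOfRecordAtBg128 F 2 K k Ω U₀ levB Gp Δ2 a hposπ hQ V))) :
          Space115Lit F 2 K k Ω U₀) =
      (bgSchemeOfRecord F 2 K k Ω U₀ dom levB Gp Δ2 a hposπ hposb hQ εC B₀ C₄ a₃ j a𝔄 ε₄).sol V + frakAOfRecordAtBg128 F 2 K k Ω U₀ levB Gp Δ2 a hposπ hQ V)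
    (hA'tr : ∀ b', (JetSup.equiv _ _ (nabla115 ((F.P K).eta k) (unitsOfRecord F 2 U₀))
      ((bgSchemeOfRecord F 2 K k Ω U₀ dom levB Gp Δ2 a hposπ hposb hQ εC B₀ C₄ a₃ j a𝔄 ε₄).sol V + frakAOfRecordAtBg128 F 2 K k Ω U₀ levB Gp Δ2 a hposπ hQ V) b').trace = 0)
    (hn : ‖(bgSchemeOfRecord F 2 K k Ω U₀ dom levB Gp Δ2 a hposπ hposb hQ εC B₀ C₄ a₃ j a𝔄 ε₄).sol V + frakAOfRecordAtBg128 F 2 K k Ω U₀ levB Gp Δ2 a hposπ hQ V‖ < aC) :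
    (bgSchemeOfRecord F 2 K k Ω U₀ dom levB Gp Δ2 a hposπ hposb hQ εC B₀ C₄ a₃ j a𝔄 ε₄).LieLinTokAt
      (fun _ => T47 (H1OfRecordAtBgFlat F 2 K k Ω U₀ levB a hposb hQ) (CslOfRecord F 2 K k Ω U₀ levB) εC) V := by
  intro bd
  set A' := (bgSchemeOfRecord F 2 K k Ω U₀ dom levB Gp Δ2 a hposπ hposb hQ εC B₀ C₄ a₃ j a𝔄 ε₄).sol V +
    frakAOfRecordAtBg128 F 2 K k Ω U₀ levB Gp Δ2 a hposπ hQ V with hA'def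
  set M : Matrix (Fin 2) (Fin 2) ℂ := JetSup.equiv _ _ (nabla115 ((F.P K).eta k) (unitsOfRecord F 2 U₀))
    (T47 (H1OfRecordAtBgFlat F 2 K k Ω U₀ levB a hposb hQ) (CslOfRecord F 2 K k Ω U₀ levB) εC A') (bondToLit (F.P K) 0 bd) with hMdef
  -- Hermitian (g26) and traceless (g27) at the lit bond `bondToLit bd`
  have hherm : Mᴴ = M := by
    have e := congrArg (fun Y : Space115Lit F 2 K k Ω U₀ => JetSup.equiv _ _ (nabla115 ((F.P K).eta k) (unitsOfRecord F 2 U₀)) Y (bondToLit (F.P K) 0 bd))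
      (conjJet_T47OfRecord_eq F 2 K k Ω U₀ levB hposb hQ RC hCreal h hA'herm hn)
    simp only [Equiv.apply_symm_apply, Pi.star_apply, Matrix.star_eq_conjTranspose] at e
    rw [hMdef]
    exact e
  have htr : M.trace = 0 := trace_equiv_T47OfRecord_eq_zero_two F k Ω U₀ levB hposb hQ RC hCreal hCtr h hA'herm hA'tr hn (bondToLit (F.P K) 0 bd)
  -- the scheme's presentation is `η • (jet value)`
  have hev : (bgSchemeOfRecord F 2 K k Ω U₀ dom levB Gp Δ2 a hposπ hposb hQ εC B₀ C₄ a₃ j a𝔄 ε₄).ev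
      ((fun _ : GaugeField (F.P K) k (SU 2) => T47 (H1OfRecordAtBgFlat F 2 K k Ω U₀ levB a hposb hQ) (CslOfRecord F 2 K k Ω U₀ levB) εC) V
        ((bgSchemeOfRecord F 2 K k Ω U₀ dom levB Gp Δ2 a hposπ hposb hQ εC B₀ C₄ a₃ j a𝔄 ε₄).sol V +
          (bgSchemeOfRecord F 2 K k Ω U₀ dom levB Gp Δ2 a hposπ hposb hQ εC B₀ C₄ a₃ j a𝔄 ε₄).𝔄 V)) bd = ((F.P K).eta k : ℂ) • M := rfl
  rw [hev]
  have hmem : ((F.P K).eta k : ℂ) • M ∈ herm0 (Fin 2) := by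
    rw [mem_herm0]
    refine ⟨?_, ?_⟩
    · show (((F.P K).eta k : ℂ) • M)ᴴ = ((F.P K).eta k : ℂ) • M
      rw [Matrix.conjTranspose_smul, hherm, Complex.star_def, Complex.conj_ofReal]
    · rw [Matrix.trace_smul, htr, smul_zero]
  exact BgScheme.I_smul_mem_lieSU_of_mem_herm0 hmem

include RC hCreal hCtr in
/-- ★ **THE `SU`-EXPONENT ROW AT THE FIXED POINT FROM THE REALITY ROWS** (`N = 2`): `exp(i·ev(T♭(𝒜♭ + 𝔄♭))(b)) ∈ SU(2)` on every bond.
[cite: Balaban1985Variational, (15) p.280, Prop. 6 p.295] -/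
theorem expoLinAt_sol_memFlat_of_rows (h : SmallBelow (avOfRecord F 2 K) k U₀) {V : GaugeField (F.P K) k (SU 2)}
    (hA'herm : ((JetSup.equiv _ _ (nabla115 ((F.P K).eta k) (unitsOfRecord F 2 U₀))).symm
      (star (JetSup.equiv _ _ (nabla115 ((F.P K).eta k) (unitsOfRecord F 2 U₀))
        ((bgSchemeOfRecord F 2 K k Ω U₀ dom levB Gp Δ2 a hposπ hposb hQ εC B₀ C₄ a₃ j a𝔄 ε₄).sol V + frakAOfRecordAtBg128 F 2 K k Ω U₀ levB Gp Δ2 a hposπ hQ V))) :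
          Space115Lit F 2 K k Ω U₀) =
      (bgSchemeOfRecord F 2 K k Ω U₀ dom levB Gp Δ2 a hposπ hposb hQ εC B₀ C₄ a₃ j a𝔄 ε₄).sol V + frakAOfRecordAtBg128 F 2 K k Ω U₀ levB Gp Δ2 a hposπ hQ V)
    (hA'tr : ∀ b', (JetSup.equiv _ _ (nabla115 ((F.P K).eta k) (unitsOfRecord F 2 U₀))
      ((bgSchemeOfRecord F 2 K k Ω U₀ dom levB Gp Δ2 a hposπ hposb hQ εC B₀ C₄ a₃ j a𝔄 ε₄).sol V + frakAOfRecordAtBg128 F 2 K k Ω U₀ levB Gp Δ2 a hposπ hQ V) b').trace = 0)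
    (hn : ‖(bgSchemeOfRecord F 2 K k Ω U₀ dom levB Gp Δ2 a hposπ hposb hQ εC B₀ C₄ a₃ j a𝔄 ε₄).sol V + frakAOfRecordAtBg128 F 2 K k Ω U₀ levB Gp Δ2 a hposπ hQ V‖ < aC)
    (b' : PBond (F.P K) 0) :
    (bgSchemeOfRecord F 2 K k Ω U₀ dom levB Gp Δ2 a hposπ hposb hQ εC B₀ C₄ a₃ j a𝔄 ε₄).expoLinAt
      (fun _ => T47 (H1OfRecordAtBgFlat F 2 K k Ω U₀ levB a hposb hQ) (CslOfRecord F 2 K k Ω U₀ levB) εC) V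
        ((bgSchemeOfRecord F 2 K k Ω U₀ dom levB Gp Δ2 a hposπ hposb hQ εC B₀ C₄ a₃ j a𝔄 ε₄).sol V) b' ∈ Matrix.specialUnitaryGroup (Fin 2) ℂ :=
  BgScheme.expoLinAt_sol_mem_of_lieLinTokAt _ _
    (lieLinTokAtFlat_of_rows F k Ω U₀ levB a hposb hQ RC hCreal hCtr Gp Δ2 hposπ dom B₀ C₄ a₃ j a𝔄 ε₄ h hA'herm hA'tr hn) b'

include RC hCreal hCtr in
/-- ★★★ **(rng) ∧ (star_mem)'s AVERAGE CONJUNCT AT THE FIXED POINT, FRAME-FREE, `N = 2`, TRACE AND `SU`-EXPONENT ROWS DISCHARGED BY THE REALITY OF `A′`**: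
`Ū^k(𝔖♭.chartCfgLin T♭ V) = V`. [cite: Balaban1985Variational, (15) p.280, (20) p.281, (44)–(48) p.285, Prop. 6 (116) p.295; Balaban1987RG1, (0.21) p.256] -/
theorem iter_chartCfgLinFlat_eq_of_realRows (h : SmallBelow (avOfRecord F 2 K) k U₀)
    (R : Regime (frakGOfRecordAtBg128 F 2 K k Ω U₀ Gp Δ2 a hposπ hQ) (0 : Space115Lit F 2 K k Ω U₀ →L[ℂ] Space115Lit F 2 K k Ω U₀)
      (WOfRecordAt F 2 K k Ω U₀ levB a hposb hQ εC Gp) B₀ 0 C₄ a₃ j a𝔄 ε₄)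
    (hJ : ‖JOfRecordAtBg F 2 K k Ω U₀‖ ≤ j) {V : GaugeField (F.P K) k (SU 2)} (h𝔄 : ‖frakAOfRecordAtBg128 F 2 K k Ω U₀ levB Gp Δ2 a hposπ hQ V‖ < a𝔄)
    (h𝔊 : FrakGSliceTok F 2 K k Ω U₀ Gp Δ2 a hposπ hQ) (haC : ε₄ + a𝔄 ≤ aC)
    (hA'herm : ((JetSup.equiv _ _ (nabla115 ((F.P K).eta k) (unitsOfRecord F 2 U₀))).symm
      (star (JetSup.equiv _ _ (nabla115 ((F.P K).eta k) (unitsOfRecord F 2 U₀))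
        ((bgSchemeOfRecord F 2 K k Ω U₀ dom levB Gp Δ2 a hposπ hposb hQ εC B₀ C₄ a₃ j a𝔄 ε₄).sol V + frakAOfRecordAtBg128 F 2 K k Ω U₀ levB Gp Δ2 a hposπ hQ V))) :
          Space115Lit F 2 K k Ω U₀) =
      (bgSchemeOfRecord F 2 K k Ω U₀ dom levB Gp Δ2 a hposπ hposb hQ εC B₀ C₄ a₃ j a𝔄 ε₄).sol V + frakAOfRecordAtBg128 F 2 K k Ω U₀ levB Gp Δ2 a hposπ hQ V)
    (hA'tr : ∀ b', (JetSup.equiv _ _ (nabla115 ((F.P K).eta k) (unitsOfRecord F 2 U₀))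
      ((bgSchemeOfRecord F 2 K k Ω U₀ dom levB Gp Δ2 a hposπ hposb hQ εC B₀ C₄ a₃ j a𝔄 ε₄).sol V + frakAOfRecordAtBg128 F 2 K k Ω U₀ levB Gp Δ2 a hposπ hQ V) b').trace = 0)
    (hguard : SmallBelow (avOfRecord F 2 K) k ((bgSchemeOfRecord F 2 K k Ω U₀ dom levB Gp Δ2 a hposπ hposb hQ εC B₀ C₄ a₃ j a𝔄 ε₄).chartCfgLin
      (fun _ => T47 (H1OfRecordAtBgFlat F 2 K k Ω U₀ levB a hposb hQ) (CslOfRecord F 2 K k Ω U₀ levB) εC) V))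
    (hdiscA : ∀ c, ‖iterMh k (coeField ((bgSchemeOfRecord F 2 K k Ω U₀ dom levB Gp Δ2 a hposπ hposb hQ εC B₀ C₄ a₃ j a𝔄 ε₄).chartCfgLin
        (fun _ => T47 (H1OfRecordAtBgFlat F 2 K k Ω U₀ levB a hposb hQ) (CslOfRecord F 2 K k Ω U₀ levB) εC) V)) c
        * star (Averaging.iter (avOfRecord F 2 K) k U₀ c : Matrix (Fin 2) (Fin 2) ℂ) - 1‖ < 1)
    (hdiscV : V ∈ logDiscOfRecord F 2 K k U₀) :
    Averaging.iter (avOfRecord F 2 K) k ((bgSchemeOfRecord F 2 K k Ω U₀ dom levB Gp Δ2 a hposπ hposb hQ εC B₀ C₄ a₃ j a𝔄 ε₄).chartCfgLin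
      (fun _ => T47 (H1OfRecordAtBgFlat F 2 K k Ω U₀ levB a hposb hQ) (CslOfRecord F 2 K k Ω U₀ levB) εC) V) = V := by
  have hn : ‖(bgSchemeOfRecord F 2 K k Ω U₀ dom levB Gp Δ2 a hposπ hposb hQ εC B₀ C₄ a₃ j a𝔄 ε₄).sol V +
      frakAOfRecordAtBg128 F 2 K k Ω U₀ levB Gp Δ2 a hposπ hQ V‖ < aC := by
    have hsol := (bgSchemeOfRecord_sol_spec F 2 K k Ω U₀ levB Gp Δ2 a hposπ hposb hQ dom R hJ h𝔄).1
    exact lt_of_lt_of_le (lt_of_le_of_lt (norm_add_le _ _) (by linarith)) haC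
  exact iter_chartCfgLinFlat_eq F 2 K k Ω U₀ levB a hposb hQ Gp Δ2 hposπ dom R hJ h𝔄 h𝔊 RC haC
    (fun b' => trace_equiv_T47OfRecord_eq_zero_two F k Ω U₀ levB hposb hQ RC hCreal hCtr h hA'herm hA'tr hn b')
    (expoLinAt_sol_memFlat_of_rows F k Ω U₀ levB a hposb hQ RC hCreal hCtr Gp Δ2 hposπ dom B₀ C₄ a₃ j a𝔄 ε₄ h hA'herm hA'tr hn) hguard hdiscA hdiscV

include RC hCreal hCtr in
/-- ★★★ **THE SAME WITH THE GUARD AND THE A-SIDE LOG-DISC ROW ALSO DISCHARGED** (`N = 2`): one radius `ρ > 0` from the guarded background and the Sect. C data such that for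
every scheme regime with `ε₄ + a𝔄 ≤ ρ` and every `V` in the log-disc with `‖𝔄♭V‖ < a𝔄` whose pre-(47) field `𝒜♭(V) + 𝔄♭(V)` is a Hermitian traceless jet:
`Ū^k(𝔖♭.chartCfgLin T♭ V) = V`. [cite: Balaban1985Variational, (20) p.281, (44)–(48) p.285, (109)–(111) p.294, Prop. 6 (115)–(116) p.295; Balaban1987RG1, (0.21) p.256] -/
theorem exists_radius_iter_chartCfgLinFlat_eq_of_realRows (h : SmallBelow (avOfRecord F 2 K) k U₀)
    (hC : Prop4Hyp (CslOfRecord F 2 K k Ω U₀ levB) C₂ c₄) (haC : 0 < aC) :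
    ∃ ρ : ℝ, 0 < ρ ∧ ρ ≤ aC ∧ ∀ (B₀ C₄ a₃ j a𝔄 ε₄ : ℝ), ε₄ + a𝔄 ≤ ρ →
      Regime (frakGOfRecordAtBg128 F 2 K k Ω U₀ Gp Δ2 a hposπ hQ) (0 : Space115Lit F 2 K k Ω U₀ →L[ℂ] Space115Lit F 2 K k Ω U₀)
        (WOfRecordAt F 2 K k Ω U₀ levB a hposb hQ εC Gp) B₀ 0 C₄ a₃ j a𝔄 ε₄ →
      ‖JOfRecordAtBg F 2 K k Ω U₀‖ ≤ j → FrakGSliceTok F 2 K k Ω U₀ Gp Δ2 a hposπ hQ →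
      ∀ {V : GaugeField (F.P K) k (SU 2)}, V ∈ logDiscOfRecord F 2 K k U₀ → ‖frakAOfRecordAtBg128 F 2 K k Ω U₀ levB Gp Δ2 a hposπ hQ V‖ < a𝔄 →
      ((JetSup.equiv _ _ (nabla115 ((F.P K).eta k) (unitsOfRecord F 2 U₀))).symm
        (star (JetSup.equiv _ _ (nabla115 ((F.P K).eta k) (unitsOfRecord F 2 U₀))
          ((bgSchemeOfRecord F 2 K k Ω U₀ dom levB Gp Δ2 a hposπ hposb hQ εC B₀ C₄ a₃ j a𝔄 ε₄).sol V + frakAOfRecordAtBg128 F 2 K k Ω U₀ levB Gp Δ2 a hposπ hQ V))) :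
            Space115Lit F 2 K k Ω U₀) =
        (bgSchemeOfRecord F 2 K k Ω U₀ dom levB Gp Δ2 a hposπ hposb hQ εC B₀ C₄ a₃ j a𝔄 ε₄).sol V + frakAOfRecordAtBg128 F 2 K k Ω U₀ levB Gp Δ2 a hposπ hQ V →
      (∀ b', (JetSup.equiv _ _ (nabla115 ((F.P K).eta k) (unitsOfRecord F 2 U₀))
        ((bgSchemeOfRecord F 2 K k Ω U₀ dom levB Gp Δ2 a hposπ hposb hQ εC B₀ C₄ a₃ j a𝔄 ε₄).sol V + frakAOfRecordAtBg128 F 2 K k Ω U₀ levB Gp Δ2 a hposπ hQ V) b').trace = 0) →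
      Averaging.iter (avOfRecord F 2 K) k ((bgSchemeOfRecord F 2 K k Ω U₀ dom levB Gp Δ2 a hposπ hposb hQ εC B₀ C₄ a₃ j a𝔄 ε₄).chartCfgLin
        (fun _ => T47 (H1OfRecordAtBgFlat F 2 K k Ω U₀ levB a hposb hQ) (CslOfRecord F 2 K k Ω U₀ levB) εC) V) = V := by
  obtain ⟨ρ, hρ, hρaC, hρrows⟩ := exists_radius_iter_chartCfgLinFlat_eq F 2 K k Ω U₀ levB a hposb hQ Gp Δ2 hposπ dom h RC hC haC
  refine ⟨ρ, hρ, hρaC, fun B₀ C₄ a₃ j a𝔄 ε₄ hfit R hJ h𝔊 V hV h𝔄 hA'herm hA'tr => ?_⟩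
  have hn : ‖(bgSchemeOfRecord F 2 K k Ω U₀ dom levB Gp Δ2 a hposπ hposb hQ εC B₀ C₄ a₃ j a𝔄 ε₄).sol V +
      frakAOfRecordAtBg128 F 2 K k Ω U₀ levB Gp Δ2 a hposπ hQ V‖ < aC := by
    have hsol := (bgSchemeOfRecord_sol_spec F 2 K k Ω U₀ levB Gp Δ2 a hposπ hposb hQ dom R hJ h𝔄).1
    exact lt_of_lt_of_le (lt_of_le_of_lt (norm_add_le _ _) (by linarith)) (hfit.trans hρaC)
  exact hρrows B₀ C₄ a₃ j a𝔄 ε₄ hfit R hJ h𝔊 hV h𝔄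
    (fun b' => trace_equiv_T47OfRecord_eq_zero_two F k Ω U₀ levB hposb hQ RC hCreal hCtr h hA'herm hA'tr hn b')
    (expoLinAt_sol_memFlat_of_rows F k Ω U₀ levB a hposb hQ RC hCreal hCtr Gp Δ2 hposπ dom B₀ C₄ a₃ j a𝔄 ε₄ h hA'herm hA'tr hn)

omit [Fact (0 < (F.L : ℝ))] [Fact (0 < (F.P K).eta k)] [Fact (0 < c0Rec F K k)] [Fact (∀ c, 0 < wBRec F K k c)] in
/-- ★ **`i·X ∈ 𝔰𝔲(N) ⟹ X` HERMITIAN TRACELESS** (converse of ✓`BgScheme.I_smul_mem_lieSU_of_mem_herm0`). [cite: Balaban1985Averaging, (17)–(19) p.21 (bookkeeping)] -/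
theorem herm0_of_I_smul_mem_lieSU {n : ℕ} {X : Matrix (Fin n) (Fin n) ℂ} (hX : Complex.I • X ∈ lieSU (Fin n)) : X ∈ herm0 (Fin n) := by
  rw [mem_lieSU_iff] at hX
  obtain ⟨h1, h2⟩ := hX
  rw [mem_herm0]
  refine ⟨?_, ?_⟩
  · have e : star (Complex.I • X) = -(Complex.I • X) := h1
    rw [star_smul, Complex.star_def, Complex.conj_I, neg_smul, neg_inj] at e
    have e' := smul_right_injective (Matrix (Fin n) (Fin n) ℂ) Complex.I_ne_zero e
    rw [Matrix.star_eq_conjTranspose] at e'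
    exact e'
  · rw [Matrix.trace_smul, smul_eq_zero] at h2
    exact h2.resolve_left Complex.I_ne_zero

/-- ★★ **THE PROP. 6 CHART's LIE TOKEN IS THE REALITY OF `A′` AS FULL JETS**: `𝔖♭.LieTokAt V` ⟹ `𝒜♭(V) + 𝔄♭(V)` is a Hermitian jet with traceless presentation at every bond
(✓`mem_evHerm0_ofRecord_iff`; `ev = η•evLit`, `η > 0`, `bondToLit` a bijection). [cite: Balaban1985Variational, (15) p.280, (19) p.281, (51) p.286, (115) p.294] -/
theorem realRows_of_lieTokAt {V : GaugeField (F.P K) k (SU 2)}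
    (hL : (bgSchemeOfRecord F 2 K k Ω U₀ dom levB Gp Δ2 a hposπ hposb hQ εC B₀ C₄ a₃ j a𝔄 ε₄).LieTokAt V) :
    ((JetSup.equiv _ _ (nabla115 ((F.P K).eta k) (unitsOfRecord F 2 U₀))).symm
      (star (JetSup.equiv _ _ (nabla115 ((F.P K).eta k) (unitsOfRecord F 2 U₀))
        ((bgSchemeOfRecord F 2 K k Ω U₀ dom levB Gp Δ2 a hposπ hposb hQ εC B₀ C₄ a₃ j a𝔄 ε₄).sol V + frakAOfRecordAtBg128 F 2 K k Ω U₀ levB Gp Δ2 a hposπ hQ V))) :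
          Space115Lit F 2 K k Ω U₀) =
      (bgSchemeOfRecord F 2 K k Ω U₀ dom levB Gp Δ2 a hposπ hposb hQ εC B₀ C₄ a₃ j a𝔄 ε₄).sol V + frakAOfRecordAtBg128 F 2 K k Ω U₀ levB Gp Δ2 a hposπ hQ V ∧
    ∀ b', (JetSup.equiv _ _ (nabla115 ((F.P K).eta k) (unitsOfRecord F 2 U₀))
      ((bgSchemeOfRecord F 2 K k Ω U₀ dom levB Gp Δ2 a hposπ hposb hQ εC B₀ C₄ a₃ j a𝔄 ε₄).sol V + frakAOfRecordAtBg128 F 2 K k Ω U₀ levB Gp Δ2 a hposπ hQ V) b').trace = 0 := by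
  have hmem : (bgSchemeOfRecord F 2 K k Ω U₀ dom levB Gp Δ2 a hposπ hposb hQ εC B₀ C₄ a₃ j a𝔄 ε₄).sol V +
      (bgSchemeOfRecord F 2 K k Ω U₀ dom levB Gp Δ2 a hposπ hposb hQ εC B₀ C₄ a₃ j a𝔄 ε₄).𝔄 V ∈
        (bgSchemeOfRecord F 2 K k Ω U₀ dom levB Gp Δ2 a hposπ hposb hQ εC B₀ C₄ a₃ j a𝔄 ε₄).evHerm0 :=
    BgScheme.mem_evHerm0_iff.2 fun bd => herm0_of_I_smul_mem_lieSU (hL bd)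
  exact (mem_evHerm0_ofRecord_iff F 2 K k Ω U₀ dom levB Gp Δ2 a hposπ hposb hQ εC B₀ C₄ a₃ j a𝔄 ε₄ _).1 hmem

include RC hCreal hCtr in
/-- ★★★★ **(rng) ∧ (star_mem)'s AVERAGE CONJUNCT FOR THE (47)-CARRYING CHART FROM THE (47)-FREE CHART's OWN LIE TOKEN** (`N = 2`, frame-free): `𝔖♭.LieTokAt V` (a theorem at
`N = 2` under displayed rows: g27 ✓`lieTokAt_bgSchemeOfRecord_two`) + the scheme regime at `V`, `FrakGSliceTok`, the Sect. C rows, the guard and the two log-disc rows ⟹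
`Ū^k(𝔖♭.chartCfgLin T♭ V) = V`. [cite: Balaban1985Variational, (15) p.280, (20) p.281, (44)–(48) p.285, Prop. 6 (115)–(116) p.295; Balaban1987RG1, (0.21) p.256] -/
theorem iter_chartCfgLinFlat_eq_of_lieTokAt (h : SmallBelow (avOfRecord F 2 K) k U₀)
    (R : Regime (frakGOfRecordAtBg128 F 2 K k Ω U₀ Gp Δ2 a hposπ hQ) (0 : Space115Lit F 2 K k Ω U₀ →L[ℂ] Space115Lit F 2 K k Ω U₀)
      (WOfRecordAt F 2 K k Ω U₀ levB a hposb hQ εC Gp) B₀ 0 C₄ a₃ j a𝔄 ε₄)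
    (hJ : ‖JOfRecordAtBg F 2 K k Ω U₀‖ ≤ j) {V : GaugeField (F.P K) k (SU 2)} (h𝔄 : ‖frakAOfRecordAtBg128 F 2 K k Ω U₀ levB Gp Δ2 a hposπ hQ V‖ < a𝔄)
    (h𝔊 : FrakGSliceTok F 2 K k Ω U₀ Gp Δ2 a hposπ hQ) (haC : ε₄ + a𝔄 ≤ aC)
    (hL : (bgSchemeOfRecord F 2 K k Ω U₀ dom levB Gp Δ2 a hposπ hposb hQ εC B₀ C₄ a₃ j a𝔄 ε₄).LieTokAt V)
    (hguard : SmallBelow (avOfRecord F 2 K) k ((bgSchemeOfRecord F 2 K k Ω U₀ dom levB Gp Δ2 a hposπ hposb hQ εC B₀ C₄ a₃ j a𝔄 ε₄).chartCfgLin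
      (fun _ => T47 (H1OfRecordAtBgFlat F 2 K k Ω U₀ levB a hposb hQ) (CslOfRecord F 2 K k Ω U₀ levB) εC) V))
    (hdiscA : ∀ c, ‖iterMh k (coeField ((bgSchemeOfRecord F 2 K k Ω U₀ dom levB Gp Δ2 a hposπ hposb hQ εC B₀ C₄ a₃ j a𝔄 ε₄).chartCfgLin
        (fun _ => T47 (H1OfRecordAtBgFlat F 2 K k Ω U₀ levB a hposb hQ) (CslOfRecord F 2 K k Ω U₀ levB) εC) V)) c
        * star (Averaging.iter (avOfRecord F 2 K) k U₀ c : Matrix (Fin 2) (Fin 2) ℂ) - 1‖ < 1)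
    (hdiscV : V ∈ logDiscOfRecord F 2 K k U₀) :
    Averaging.iter (avOfRecord F 2 K) k ((bgSchemeOfRecord F 2 K k Ω U₀ dom levB Gp Δ2 a hposπ hposb hQ εC B₀ C₄ a₃ j a𝔄 ε₄).chartCfgLin
      (fun _ => T47 (H1OfRecordAtBgFlat F 2 K k Ω U₀ levB a hposb hQ) (CslOfRecord F 2 K k Ω U₀ levB) εC) V) = V := by
  obtain ⟨hA'herm, hA'tr⟩ := realRows_of_lieTokAt F k Ω U₀ levB a hposb hQ Gp Δ2 hposπ dom B₀ C₄ a₃ j a𝔄 ε₄ (εC := εC) hL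
  exact iter_chartCfgLinFlat_eq_of_realRows F k Ω U₀ levB a hposb hQ RC hCreal hCtr Gp Δ2 hposπ dom B₀ C₄ a₃ j a𝔄 ε₄ h R hJ h𝔄 h𝔊 haC hA'herm hA'tr
    hguard hdiscA hdiscV

include RC hCreal hCtr in
/-- ★★★★ **THE SAME WITH THE GUARD AND THE A-SIDE LOG-DISC ROW DISCHARGED** (`N = 2`, frame-free): one radius `ρ > 0` (background + Sect. C data) such that for every scheme regime with
`ε₄ + a𝔄 ≤ ρ` and every `V` in the log-disc with `‖𝔄♭V‖ < a𝔄` at which the (47)-free chart's Lie token holds: `Ū^k(𝔖♭.chartCfgLin T♭ V) = V`.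
[cite: Balaban1985Variational, (20) p.281, (44)–(48) p.285, (109)–(111) p.294, Prop. 6 (115)–(116) p.295; Balaban1987RG1, (0.21) p.256] -/
theorem exists_radius_iter_chartCfgLinFlat_eq_of_lieTokAt (h : SmallBelow (avOfRecord F 2 K) k U₀)
    (hC : Prop4Hyp (CslOfRecord F 2 K k Ω U₀ levB) C₂ c₄) (haC : 0 < aC) :
    ∃ ρ : ℝ, 0 < ρ ∧ ρ ≤ aC ∧ ∀ (B₀ C₄ a₃ j a𝔄 ε₄ : ℝ), ε₄ + a𝔄 ≤ ρ →
      Regime (frakGOfRecordAtBg128 F 2 K k Ω U₀ Gp Δ2 a hposπ hQ) (0 : Space115Lit F 2 K k Ω U₀ →L[ℂ] Space115Lit F 2 K k Ω U₀)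
        (WOfRecordAt F 2 K k Ω U₀ levB a hposb hQ εC Gp) B₀ 0 C₄ a₃ j a𝔄 ε₄ →
      ‖JOfRecordAtBg F 2 K k Ω U₀‖ ≤ j → FrakGSliceTok F 2 K k Ω U₀ Gp Δ2 a hposπ hQ →
      ∀ {V : GaugeField (F.P K) k (SU 2)}, V ∈ logDiscOfRecord F 2 K k U₀ → ‖frakAOfRecordAtBg128 F 2 K k Ω U₀ levB Gp Δ2 a hposπ hQ V‖ < a𝔄 →
      (bgSchemeOfRecord F 2 K k Ω U₀ dom levB Gp Δ2 a hposπ hposb hQ εC B₀ C₄ a₃ j a𝔄 ε₄).LieTokAt V →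
      Averaging.iter (avOfRecord F 2 K) k ((bgSchemeOfRecord F 2 K k Ω U₀ dom levB Gp Δ2 a hposπ hposb hQ εC B₀ C₄ a₃ j a𝔄 ε₄).chartCfgLin
        (fun _ => T47 (H1OfRecordAtBgFlat F 2 K k Ω U₀ levB a hposb hQ) (CslOfRecord F 2 K k Ω U₀ levB) εC) V) = V := by
  obtain ⟨ρ, hρ, hρaC, hρrows⟩ := exists_radius_iter_chartCfgLinFlat_eq_of_realRows F k Ω U₀ levB a hposb hQ RC hCreal hCtr Gp Δ2 hposπ dom h hC haC
  refine ⟨ρ, hρ, hρaC, fun B₀ C₄ a₃ j a𝔄 ε₄ hfit R hJ h𝔊 V hV h𝔄 hL => ?_⟩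
  obtain ⟨hA'herm, hA'tr⟩ := realRows_of_lieTokAt F k Ω U₀ levB a hposb hQ Gp Δ2 hposπ dom B₀ C₄ a₃ j a𝔄 ε₄ (εC := εC) hL
  exact hρrows B₀ C₄ a₃ j a𝔄 ε₄ hfit R hJ h𝔊 hV h𝔄 hA'herm hA'tr

end Two

end Summit.QuantumFields.YangMills.Theorems.N07ChartLinFlatLieTok

end
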